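import Summits.QuantumFields.GaugeBoot.DiagonalRPTorusInnerHalfNegativeThreeAll
import Summits.QuantumFields.GaugeBoot.DiagonalRPTorusInnerHalfNegativeHighDimMain
import Summits.QuantumFields.GaugeBoot.DiagonalRPTorusClosedHalfNegativeHighDimGroups
import HarnessLib

/-!
# Diagonal RP fails on every torus `(ℤ/L)^d`, `d ≥ 3`, `L ≥ 3`, for `SU(N)` and `U(N)` at small
coupling — the assembled statement (gauge-boot, task L3 sequel; summary file)

HONEST FRAMING (cell `pub-gaugeboot`, page 1 of every file): the venture produces certified bounds
on lattice expectations at stated coupling, gauge group, dimension and torus size; NOT a mass gap,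
NOT a continuum limit, NOT a string tension; NOT Yang–Mills-summit-bearing (barriers
`FixedCouplingUltralocality`, `PerturbativeInvisibility`). This module only ASSEMBLES the tree's
structural NEGATIVE results about which positivity constraints a TORUS certificate may use; it
discharges nothing else.

## Content

One statement per gauge group, by cases on the parity of `L` and on `d = 3` / `d ≥ 4`:

| case | half | file |
|---|---|---|
| `d = 3`, `L` odd `≥ 3` | closed | `DiagRPSUN.not_diagonalReflectionPositive_odd_suN` / `_uN` (L3(ξ), gen 33/34) |
| `d = 3`, `L` even `≥ 4` | inner | `DiagRPRest.not_innerDiagonalRP_even_three_suN` / `_uN` (this sequel) |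
| `d ≥ 4`, `L` odd `≥ 3` | closed | `DiagRPTube.not_diagonalReflectionPositive_odd_suN_highDim'` / `_uN_highDim'` |
| `d ≥ 4`, `L` even `≥ 4` | inner | `DiagRPTube.not_innerDiagonalRP_even_suN_highDim` / `_uN_highDim` |

* **`diagonalRP_fails_suN`** — `SU(N)`, `N ≥ 2`, mirror `x₀ = x₁`: for every `d ≥ 3` and every
  `L ≥ 3` there is `β₀ = β₀(d, L, N) > 0` such that for all `0 < β ≤ β₀`: if `L` is odd the
  closed-half diagonal RP `DiagonalReflectionPositive` fails, and if `L` is even the inner-half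
  diagonal RP `InnerDiagonalRP` fails (on even tori the closed half fails trivially,
  `not_diagonalReflectionPositive`; the inner half is the meaningful statement);
* **`diagonalRP_fails_uN`** — the same for `U(N)`, `N ≥ 1` (`N = 1`: compact `U(1)`).

`β₀` is EXISTENTIAL and depends on `L` (no uniform window, hence no statement about
infinite-volume limit states beyond what `TiltedBoxLimitDiagonalRP` / `ClassB*` record). Printed
precedent for the phenomenon (spin systems, no proof): Fröhlich–Israel–Lieb–Simon, J. Stat. Phys.
22 (1980) 297, §3; Biskup, LNM 1970 (2009) §5.5; the positivity used by the bootstrap literature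
is the `ℤ^d` / untwisted one (Kazakov–Zheng 2022 §3.1).
-/

namespace Summit.QuantumFields.GaugeBoot

open Literature.MathematicalPhysics.QuantumFieldTheory
open Literature.MathematicalPhysics.QuantumLattice

noncomputable section

namespace DiagRPRest

/-- ★★★ **Diagonal RP fails on every torus for `SU(N)`.** For `N ≥ 2`, every dimension `d ≥ 3`
and every side `L ≥ 3` there is `β₀ > 0` such that for all `0 < β ≤ β₀` the lattice `SU(N)`
Wilson theory on `(ℤ/L)^d` violates diagonal reflection positivity across `x₀ = x₁`: the
closed-half form when `L` is odd, the inner-half form when `L` is even. -/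
theorem diagonalRP_fails_suN {d L N : ℕ} [NeZero L] (hd : 3 ≤ d) (hL : 3 ≤ L) (hN : 2 ≤ N) :
    ∃ β₀ : ℝ, 0 < β₀ ∧ ∀ β : ℝ, 0 < β → β ≤ β₀ →
      (Odd L → ¬ DiagonalReflectionPositive (d := d) (L := L) (fundamentalRep (Fin N)) β
          ⟨0, by omega⟩ ⟨1, by omega⟩) ∧
        (Even L → ¬ InnerDiagonalRP (d := d) (L := L) (fundamentalRep (Fin N)) β
          ⟨0, by omega⟩ ⟨1, by omega⟩) := by
  rcases Nat.even_or_odd L with hLe | hLo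
  · have h4 : 4 ≤ L := by obtain ⟨c, hc⟩ := hLe; omega
    have hno : ¬ Odd L := Nat.not_odd_iff_even.2 hLe
    rcases (show d = 3 ∨ 4 ≤ d by omega) with rfl | hd4
    · obtain ⟨β₀, hβ₀, h⟩ := not_innerDiagonalRP_even_three_suN (L := L) hN hLe h4
      exact ⟨β₀, hβ₀, fun β hβ hβ1 => ⟨fun hLo => absurd hLo hno, fun _ => h β hβ hβ1⟩⟩
    · obtain ⟨β₀, hβ₀, h⟩ := DiagRPTube.not_innerDiagonalRP_even_suN_highDim hd4 hN hLe h4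
      exact ⟨β₀, hβ₀, fun β hβ hβ1 => ⟨fun hLo => absurd hLo hno, fun _ => h β hβ hβ1⟩⟩
  · have hne : ¬ Even L := Nat.not_even_iff_odd.2 hLo
    rcases (show d = 3 ∨ 4 ≤ d by omega) with rfl | hd4
    · obtain ⟨β₀, hβ₀, h⟩ := DiagRPSUN.not_diagonalReflectionPositive_odd_suN (L := L) hN hLo hL
      exact ⟨β₀, hβ₀, fun β hβ hβ1 => ⟨fun _ => h β hβ hβ1, fun hLe => absurd hLe hne⟩⟩
    · obtain ⟨β₀, hβ₀, h⟩ := DiagRPTube.not_diagonalReflectionPositive_odd_suN_highDim' hd4 hN hLo hL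
      exact ⟨β₀, hβ₀, fun β hβ hβ1 => ⟨fun _ => h β hβ hβ1, fun hLe => absurd hLe hne⟩⟩

/-- ★★★ **Diagonal RP fails on every torus for `U(N)`** (`N ≥ 1`; `N = 1` is compact `U(1)`):
the same statement for the defining representation of `Matrix.unitaryGroup (Fin N) ℂ`. -/
theorem diagonalRP_fails_uN {d L N : ℕ} [NeZero L] (hd : 3 ≤ d) (hL : 3 ≤ L) (hN : 1 ≤ N) :
    ∃ β₀ : ℝ, 0 < β₀ ∧ ∀ β : ℝ, 0 < β → β ≤ β₀ →
      (Odd L → ¬ DiagonalReflectionPositive (d := d) (L := L) (unitaryFundamentalRep (Fin N) ℂ) β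
          ⟨0, by omega⟩ ⟨1, by omega⟩) ∧
        (Even L → ¬ InnerDiagonalRP (d := d) (L := L) (unitaryFundamentalRep (Fin N) ℂ) β
          ⟨0, by omega⟩ ⟨1, by omega⟩) := by
  rcases Nat.even_or_odd L with hLe | hLo
  · have h4 : 4 ≤ L := by obtain ⟨c, hc⟩ := hLe; omega
    have hno : ¬ Odd L := Nat.not_odd_iff_even.2 hLe
    rcases (show d = 3 ∨ 4 ≤ d by omega) with rfl | hd4
    · obtain ⟨β₀, hβ₀, h⟩ := not_innerDiagonalRP_even_three_uN (L := L) hN hLe h4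
      exact ⟨β₀, hβ₀, fun β hβ hβ1 => ⟨fun hLo => absurd hLo hno, fun _ => h β hβ hβ1⟩⟩
    · obtain ⟨β₀, hβ₀, h⟩ := DiagRPTube.not_innerDiagonalRP_even_uN_highDim hd4 hN hLe h4
      exact ⟨β₀, hβ₀, fun β hβ hβ1 => ⟨fun hLo => absurd hLo hno, fun _ => h β hβ hβ1⟩⟩
  · have hne : ¬ Even L := Nat.not_even_iff_odd.2 hLo
    rcases (show d = 3 ∨ 4 ≤ d by omega) with rfl | hd4
    · obtain ⟨β₀, hβ₀, h⟩ := DiagRPSUN.not_diagonalReflectionPositive_odd_uN (L := L) hN hLo hL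
      exact ⟨β₀, hβ₀, fun β hβ hβ1 => ⟨fun _ => h β hβ hβ1, fun hLe => absurd hLe hne⟩⟩
    · obtain ⟨β₀, hβ₀, h⟩ := DiagRPTube.not_diagonalReflectionPositive_odd_uN_highDim' hd4 hN hLo hL
      exact ⟨β₀, hβ₀, fun β hβ hβ1 => ⟨fun _ => h β hβ hβ1, fun hLe => absurd hLe hne⟩⟩

end DiagRPRest

end

end Summit.QuantumFields.GaugeBoot
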